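import Mathlib
import Summits.Langlands.Langlands.Theorems.QuadraticWindowHostInducedRepInducedPackage
import Summits.Langlands.Langlands.Theorems.QuadraticWindowHostInducedRepSignedTwistAux
import Summits.Langlands.Langlands.Theorems.QuadraticWindowHostInducedRepPackageSign
import Summits.Langlands.Langlands.Theorems.QuadraticWindowHostInducedRepPackageHecke
import Summits.Langlands.Langlands.Theorems.QuadraticWindowHostInducedRepPatchDescend
import Literature.NumberTheory.Automorphic.ReciprocityGLnExistenceProofs
import Literature.NumberTheory.Automorphic.AsaiSign
import Literature.NumberTheory.Automorphic.WeaklyRegularGaloisRep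
import Literature.NumberTheory.Automorphic.BaseChangeInductionAlong
import Literature.NumberTheory.Automorphic.TunnellOctahedralGlobal
import Literature.NumberTheory.Automorphic.AutomorphicTwistHecke
import Literature.NumberTheory.Automorphic.BookerKrishnamurthyConverse
import Literature.NumberTheory.Automorphic.AdeleBaseChange
import Literature.NumberTheory.Automorphic.AutomorphicInductionCuspidalUnramified
import Literature.NumberTheory.Automorphic.BaseChangeArchimedean
import Literature.NumberTheory.Automorphic.HenniartAutomorphicInduction
import Literature.NumberTheory.Automorphic.BaseChangeUnramifiedLift
import Literature.NumberTheory.GaloisRepresentations.GlobalArtinMapNormProofs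
import Literature.NumberTheory.GaloisRepresentations.ArtinCharacterReciprocityProofs
import Literature.NumberTheory.GaloisRepresentations.AbsGaloisGroup
import Literature.NumberTheory.QuadraticForms.QuadraticExtensionPlaces
import Literature.NumberTheory.GaloisRepresentations.ArtinCharacterReciprocityArchimedean
import Summits.Langlands.Langlands.Theorems.QuadraticWindowHostInducedRepPaneDefs
import Summits.Langlands.Langlands.Theorems.QuadraticWindowHostInducedRepMemberSign
import Summits.Langlands.Langlands.Theorems.QuadraticWindowHostInducedRepPackageFamily
import Summits.Langlands.Langlands.Theorems.QuadraticWindowHostInducedRepMemberTower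
import Summits.Langlands.Langlands.Theorems.QuadraticWindowHostInducedRepMemberSatake
import Summits.Langlands.Langlands.Theorems.QuadraticWindowHostInducedRepMemberArch
import Summits.Langlands.Langlands.Theorems.QuadraticWindowHostInducedRepMemberPaneArch
import Summits.Langlands.Langlands.Theorems.QuadraticWindowHostInducedRepMemberParity

/-!
# The member statement `pkg_member` of stub `stub_package` ASSEMBLED from its six landed sub-stubs,
# and the reshaped `stub_package` (`stub_package''`) — line `one-transparent-pane`, crux
# `Summit.Langlands.Langlands.Theses.QuadraticWindow.HostInducedRep` (stmt-Langlands-10902)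

LEAD (2026-08-16 16:20Z): this is the wave-2 worker's `PackageSplit.lean` with the five sorried sub-stubs REPLACED by
imports of their landed proofs (p96267 Tower, p113730 Satake, p103699 Arch, p104124 PaneArch, p97732 Parity, p95489 Sign);
sorry-free. Registered anchor: `packageCompose_anchor`.

LOG (wave 2 worker `pkg_member`, 2026-08-16).

## LOG (end of wave 2)
* T1 LANDED (all ACCEPTED, `--supports stmt-Langlands-10902`, anchors registered by `stub-add`):
  p93911 `Theorems/QuadraticWindowHostInducedRepPackageSign.lean` (anchor `packageSign_anchor`),
  p93979 `…PackageDict.lean` (`packageDict_anchor`), p94002 `…PackageHecke.lean` (`packageHecke_anchor`),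
  p94059 `…PackagePolar.lean` (`packagePolar_anchor`), p95457 `…PackageFamily.lean` (registered
  `stub_package_of_member`, hypothesis `hmember` in the `MemberPkg` form, 3552 chars).
* p95188 `…PaneDefs.lean` ACCEPTED (definition kind, async audit): the interface predicates
  `MemberDict`, `MemberPkg`, `MuHyp`, `IsPaneTower`, `MemberRel`, `SatakeOut`, `ArchOut`, `PaneArchOut`,
  `ParityOut` (anchor `paneDefs_anchor`).  GOTCHA met: closed `def X : Prop` in a Theorems file are
  RELOCATED to Literature as named facts (v1 p95124/p95125 bounced harmlessly) — so the three statements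
  consumed by the sign step (`hex`, `stub_signPin`, `stub_paneLaw` conclusion) are spelled out INLINE.
* p94653 `Literature/NumberTheory/GaloisRepresentations/ArtinCharacterReciprocityArchimedean.lean` ACCEPTED:
  NEW named fact `artinReciprocity_character_archimedean` (Tate, Cassels–Fröhlich VII §6.3–6.4:
  `ω_w(-1) = det χ(c_w)` for the Hecke character of a rank-one Artin representation) — the crux's parity
  hypotheses `hpar`, `hψpar` are Galois-side, the type-I criterion is Hecke-side.
* SPLIT of `pkg_member` into SIX registered sub-stubs (all `stub-add`ed on stmt-Langlands-10902; sizes in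
  chars of the registered text / size class of the proof):
  - `stub_memberTower` (575 / M): the biquadratic pane tower `L = F·K`, `F'`, `s` as TYPES + `IsPaneTower`;
    pure field theory, fact-free.  OPEN.
  - `stub_memberSatake` (2654 / XL): all finite-place constructions (induced package, placewise BC to `K`
    and to `L`, `ψu` by `hext`, twists, `MemberRel`, dictionary via the landed `member_dictionary`,
    conjugate self-dualities a.e. via the landed `inducedParam_map_inv`, `τ' = AI_{L/K}(P)` a.e.);
    facts `hAI` (named), `hBC`, `hext` (inline).  OPEN.
  - `stub_memberArch` (1305 / L): infinity type of `τ'`, weak regularity, type-I criterion (`ArchOut`);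
    facts `harch`, `hHen`, `hinf`.  OPEN.
  - `stub_memberPaneArch` (1424 / L): pane parameter of `P` (`PaneArchOut`); facts `harch`, `hinf`.  OPEN.
  - `stub_memberParity` (866 / M): `ParityOut` from `hpar`, `hψpar`, the quadratic Artin characters
    (`quadraticArtinChar`) and the new fact `artinReciprocity_character_archimedean`.  OPEN.
  - `stub_memberSign` (2896 / M): PROVED and LANDED, p95489 `…MemberSign.lean` (pure logic + `hex` +
    `hpin` + `hpane`; `complexConj K = cK`, transport to the base `K⁺`).
* CHECKED COMPOSITION (this file, rc 0, sorries = the five open sub-stubs): `pkg_member_of_split`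
  (facts `hAI hBC hext harch hHen hinf hCFT hex hpin hpane` → crux data with `Hyps` → `¬ IsTotallyReal F` →
  CM quadratic `K` ramified at a guarded place, `IsEmpty (F →ₐ[F₀] K)` → `MemberPkg F₀ π ι eψ K`) and
  `stub_package''` = landed `stub_package_of_member` ∘ `pkg_member_of_split` (the family output consumed by
  the landed `stub_patch` through `stub_galoisOverK`).  NOTE for the lead: the member statement now takes
  the crux hypotheses as the bundle `Hyps τ n π e k ℓ eψ` (all of them) instead of the shorter registered
  prefix of `stub_package`; `HostInducedRep_of` has them all in context.
* Design of the split (why six, and the quantifier structure): the sign choices are `μ ∈ {1, ω_K, ω_F,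
  ω_K ω_F}` on the HECKE side (`MuHyp`: finite order, `μ(ϖ_v) = ±1` a.e., `= 1` at places split in `K` and
  `F` — exactly what the Satake-level conjugate self-duality tolerates, using `B = -B` at `F`-inert places);
  the Artin avatars `χe, ω` and `ω₀ = ω|_{F₀}` are INPUTS of SATAKE/PARITY (chosen once by the composition
  from the proved `artinReciprocity_character_holds`, `heckeCharacter_exists_restrict`) so that the parity
  function `θ = χe ω₀` is the same for all four `μ`; ARCH and PANE-ARCH consume only `MemberRel` (the
  defining relations), never SATAKE's proof; the archimedean behaviour of `ψu` is read through the
  restriction identity and unitarity (no classification of unitary characters of `ℂˣ` is assumed: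
  `ψu((e^a)_u) = e^{ap+āq}`, unitarity and finite order of `χ₀` force `p = -q = m_u/2`).

## Hints for the wave-3 workers (tree API met while designing the split)
* TOWER: `Literature.NumberTheory.QuadraticForms.QuadraticExtension.{exists_algEquiv_ne_one,
  algEquiv_eq_one_or_eq, exists_algebraMap_eq_of_fixed}`; `ComplexEmbedding.exists_comp_symm_eq_of_comp_eq`
  (conjugate of an embedding = embedding ∘ Galois element), `IsTotallyReal.complexEmbedding_isReal`,
  `IsTotallyComplex.complexEmbedding_not_isReal`, `ComplexEmbedding.IsConj` (`conjugate φ = φ.comp σ`);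
  Klein-group bookkeeping in `work/stubs/AsaiTowerPlaces.lean` (asaiPoleInduced worker);
  `NumberField.of_subfield`; mind the reserved token `Π` (name nothing `Π…`).
* SATAKE: `stub_inducedPackage_of_automorphicInduction` (landed, needs `Hyps`), `IsUnramifiedBaseChangeLift`,
  `exists_cuspidalAutomorphicRepData_twist_hecke` (`[NeZero n]`), `HeckeCharacter.compRelNorm` (needs
  `[IsGalois K L]`), `exists_heckeCharacter_ideleNorm_cpow`, landed `member_dictionary(_split)`,
  `hasSatakeParamAt_twist_hecke_placewise`, `valueAtUniformizer_restrict`, `isUnramifiedAt_restrict`,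
  `inducedParam_map_inv`, `map_mul_eq_map_inv_of_mul_eq`, `map_mul_eq_map_inv_self`, `map_pow_map_inv`;
  a.e. forms `IsAutomorphicInductionAlong.eventually_exists`, `eventually_guard`;
  `BaseChangeOfAutomorphicInduction.eventually_hasSatakeParamAt_sum_smul` (AI ∘ BC a.e.); the set `U` for
  `hext`: all places over guarded `v` unramified in `K` with `χ₀` unramified at `v`, plus ONE place over each
  guarded `v` split in `K` with `χ₀` ramified (coverage clause); `MuHyp` at `F`-inert places uses `B = -B`.
* ARCH / PANE-ARCH: `Henniart2012_infinityType_of_automorphicInduction.quadratic` (a.e. `∃ α β` form,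
  CUSPIDAL data), `ArthurClozel1989_strongLifting_archimedean.hasInfinityType_baseChange`
  (`IsWeakBaseChangeLiftAE`, `[IsGalois]`, cyclic prime degree), `RegularTwistCM.hasArchParameter_twist_glOne`,
  `HalfIntegralTwistCM.Negative.{archParam_complexPlace_glOne, archParam_embedding_sub_conj_mem_int_glOne,
  detTwist_datum_heckeCharacter}` (Theorems files, importable), `HasArchParameter.twist`
  (`AutomorphicTwistWeightOne`), `HeckeCharacter.archComponent`/`infiniteIdeleSingle`
  (`BookerKrishnamurthyConverse`); the infinite components of `AdeleRing.ideleBaseChange` /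
  `ideleRelNorm` are the pieces most likely missing API.
* PARITY: `quadraticArtinChar`, `quadraticArtinChar_apply_frob_coe`, `quadraticArtinChar_apply_eq_one_iff`,
  `exists_heckeCharacter_quadraticSign_of_reciprocity_quadraticArtinChar`, `artinReciprocity_character_holds`,
  `IsComplexConjugationAt`, `exists_isComplexConjugation`, `FramedGaloisRep.isOdd_iff?`/`IsOdd` unfolding,
  `restrictField`; the new fact `artinReciprocity_character_archimedean` (Literature, landed).
-/

open scoped BigOperators Polynomial Classical
open Filter Set Polynomial IsDedekindDomain NumberField
open Literature.NumberTheory.Automorphic Literature.NumberTheory.GaloisRepresentations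
open Literature.NumberTheory.GaloisRepresentations.QuadraticFamily
open Literature.NumberTheory.Automorphic.PatchingFamily
open Summit.Langlands.Langlands.Theorems.HostInducedRep.GrsExplicitDescent

set_option linter.dupNamespace false

noncomputable section

namespace Summit.Langlands.Langlands.Theorems.HostInducedRep.OneTransparentPane

-- The six sub-stubs `stub_memberTower`, `stub_memberSatake`, `stub_memberArch`, `stub_memberPaneArch`,
-- `stub_memberParity`, `stub_memberSign` are ALL LANDED (Theorems/QuadraticWindowHostInducedRepMember*.lean) and imported.

/-! ## The checked composition -/

section Compose

/-- **`pkg_member` from the six sub-stubs (CHECKED COMPOSITION).**  Facts in front (`hAI`, `hBC`,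
`hext`, `harch`, `hHen`, `hinf`, `hCFT`, `hex`, `hpin`, `hpane`), then the crux data with `Hyps`,
`F` not totally real, and the CM quadratic `K/F₀` ramified at a guarded place with no `F₀`-embedding
of `F`; conclusion `MemberPkg`.  Threading: `cK` (`exists_algEquiv_ne_one`), the tower
(`stub_memberTower`), the Artin avatars `χe, ω` (`artinReciprocity_character_holds`, PROVED class
field theory) and the restriction `ω₀` (`heckeCharacter_exists_restrict`), the parity output
(`stub_memberParity`), and for every admissible `μ` the objects of `stub_memberSatake` with the
infinity type of `stub_memberArch` and the pane parameter of `stub_memberPaneArch`; `stub_memberSign`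
concludes. -/
theorem pkg_member_of_split
    (hAI : automorphicInduction_cyclic_cuspidal_unramified)
    (hBC : ∀ (n : ℕ) (F E : Type) [Field F] [NumberField F] [Field E] [NumberField E] [Algebra F E]
      [IsGalois F E], (Module.finrank F E).Prime →
      ∀ (hF : isCompact_glFiniteIntegralLevel n F) (π : CuspidalAutomorphicRepData n F hF),
        (∃ v : HeightOneSpectrum (𝓞 F), ¬ Algebra.IsUnramifiedIn (𝓞 E) v.asIdeal ∧ π.1.IsUnramifiedAt v) →
        ∀ (hE : isCompact_glFiniteIntegralLevel n E),
          ∃ P : CuspidalAutomorphicRepData n E hE, IsUnramifiedBaseChangeLift π.1 P.1)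
    (hext : ∀ (F₀ K : Type) [Field F₀] [NumberField F₀] [Field K] [NumberField K] [Algebra F₀ K]
      (c : K ≃ₐ[F₀] K), Module.finrank F₀ K = 2 → c ≠ 1 →
      ∀ (χ₀ : HeckeCharacter F₀), χ₀.IsUnitary →
      ∀ (U : Set (HeightOneSpectrum (𝓞 K))),
        (∀ u ∈ U, c • u ∈ U → χ₀.IsUnramifiedAt (u.under (𝓞 F₀))) →
        ∃ χ : HeckeCharacter K, χ.IsUnitary ∧
          (∀ x, χ (AdeleRing.ideleBaseChange F₀ K x) = χ₀ x) ∧ ∀ u ∈ U, χ.IsUnramifiedAt u)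
    (harch : ArthurClozel1989_strongLifting_archimedean)
    (hHen : Henniart2012_infinityType_of_automorphicInduction)
    (hinf : ∀ (N : ℕ) (K : Type) [Field K] [NumberField K] (hK : isCompact_glFiniteIntegralLevel N K)
      (P : AutomorphicRepData (AutomorphyDatum.gl N K hK)), P.exists_hasInfinityType)
    (hCFT : artinReciprocity_character_archimedean)
    (hex : ∀ (F E : Type) [Field F] [NumberField F] [Field E] [NumberField E] [Algebra F E] (c : E ≃ₐ[F] E), Module.finrank F E = 2 → c ≠ 1 → ∀ (N : ℕ) (hcpt : isCompact_glFiniteIntegralLevel N E) (P : CuspidalAutomorphicRepData N E hcpt), 0 < N → P.1.IsConjSelfDualAE c → ∃ κ : ℤˣ, P.1.HasAsaiSign c κ)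
    (hpin : ∀ (F E : Type) [Field F] [NumberField F] [Field E] [NumberField E] [Algebra F E] (c : E ≃ₐ[F] E), Module.finrank F E = 2 → c ≠ 1 → ∀ (N : ℕ) (hcpt : isCompact_glFiniteIntegralLevel N E) (P : CuspidalAutomorphicRepData N E hcpt) (κ : ℤˣ) (χ : (E →+* ℂ) → Multiset ℂ) (σ : E →+* ℂ) (r : ℝ), 0 < N → P.1.IsConjSelfDualAE c → P.1.HasAsaiSign c κ → P.1.HasArchParameter χ → NumberField.ComplexEmbedding.IsConj σ c → (χ σ).Nodup → (∀ a ∈ χ σ, ∃ m : ℤ, a = (m : ℂ) + (r : ℂ)) → ∀ a ∈ χ σ, ∃ m : ℤ, a = (m : ℂ) + ((N : ℂ) - 1) / 2 + (1 - ((κ : ℤ) : ℂ)) / 4)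
    (hpane : ∀ (F₀ K F' L : Type) [Field F₀] [NumberField F₀] [Field K] [NumberField K] [Field F'] [NumberField F'] [Field L] [NumberField L] [Algebra F₀ K] [Algebra K L] [Algebra F' L] (cK : K ≃ₐ[F₀] K) (s : L ≃ₐ[F'] L), Module.finrank F₀ K = 2 → Module.finrank K L = 2 → Module.finrank F' L = 2 → cK ≠ 1 → s ≠ 1 → (∀ x : K, s (algebraMap K L x) = algebraMap K L (cK x)) → ∀ (n : ℕ) (hL : isCompact_glFiniteIntegralLevel n L) (hK : isCompact_glFiniteIntegralLevel (2 * n) K) (P : CuspidalAutomorphicRepData n L hL) (Q : CuspidalAutomorphicRepData (2 * n) K hK) (χ : (L →+* ℂ) → Multiset ℂ) (σ : L →+* ℂ), 0 < n → IsAutomorphicInductionAlong P.1 Q.1 → P.1.IsConjSelfDualAE s → Q.1.IsConjSelfDualAE cK → P.1.HasArchParameter χ → NumberField.ComplexEmbedding.IsConj σ s → (χ σ).Nodup → Multiset.card (χ σ) = n → (∀ a ∈ χ σ, ∃ m : ℤ, a = (m : ℂ) + 1 / 2) → Q.1.HasAsaiSign cK 1) :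
    ∀ (F₀ F : Type) [Field F₀] [NumberField F₀] [Field F] [NumberField F] [Algebra F₀ F]
      (τ : F ≃ₐ[F₀] F) (n : ℕ) (hcpt : isCompact_glFiniteIntegralLevel n F)
      (π : CuspidalAutomorphicRepData n F hcpt) (e : FramedGaloisRep F₀ ℂ 1) (k : ℤ)
      (ℓ : ℕ) [Fact ℓ.Prime] (ι : PadicAlgCl ℓ ≃+* ℂ) (eψ : FramedGaloisRep F ℂ 1),
      Hyps τ n π e k ℓ eψ → ¬ IsTotallyReal F →
    ∀ (K : Type) [Field K] [NumberField K] [Algebra F₀ K] [IsCMField K],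
      Module.finrank F₀ K = 2 →
      (∃ v₀ : HeightOneSpectrum (𝓞 F₀), ¬ Algebra.IsUnramifiedIn (𝓞 K) v₀.asIdeal ∧
        ∃ (α : HeightOneSpectrum (𝓞 F) → Multiset ℂ) (c : HeightOneSpectrum (𝓞 F) → ℂ),
          Guard π eψ v₀ α c) →
      IsEmpty (F →ₐ[F₀] K) → MemberPkg F₀ π ι eψ K := by
  intro F₀ F _ _ _ _ _ τ n hcpt π e k ℓ _ ι eψ hH hF K _ _ _ _ h2 hram hemp
  obtain ⟨hTR, hdeg, hτ, -⟩ := id hH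
  -- the involution of `K/F₀`
  haveI : Algebra.IsQuadraticExtension F₀ K := ⟨h2⟩
  obtain ⟨cK, hcK⟩ :=
    Literature.NumberTheory.QuadraticForms.QuadraticExtension.exists_algEquiv_ne_one (K := F₀) (E := K)
  -- the pane tower
  obtain ⟨L, F', _, _, _, _, _, _, _, _, _, _, _, s, hT⟩ :=
    stub_memberTower F₀ F τ hTR hdeg hτ K cK h2 hcK hemp
  -- the Artin avatars and the restriction
  obtain ⟨χe, hχefin, hχe⟩ := artinReciprocity_character_holds F₀ e
  obtain ⟨ω, hfin, hω⟩ := artinReciprocity_character_holds F eψ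
  obtain ⟨ω₀, hω₀⟩ := heckeCharacter_exists_restrict F₀ ω
  -- parity, then the sign step over the Satake / arch / pane-arch outputs
  have hpar := stub_memberParity hCFT F₀ F τ n hcpt π e k ℓ eψ hH K h2 χe ω ω₀ hχe hω hω₀
  refine stub_memberSign hex hpin hpane F₀ F τ n hcpt π e k ℓ ι eψ hH hF K cK h2 hcK L F' s hT
    (χe * ω₀) hpar fun μ hμ ↦ ?_
  obtain ⟨ψu, νk, ν, Pind, PiK, τ', P₀, P, hrel, hout⟩ :=
    stub_memberSatake hAI hBC hext F₀ F τ n hcpt π e k ℓ ι eψ hH K cK h2 hcK hram L F' s hT χe ω hfin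
      ω₀ hχe hχefin hω hω₀ μ hμ
  obtain ⟨T, hT'⟩ := stub_memberArch harch hHen hinf F₀ F τ n hcpt π e k ℓ eψ hH K h2 L μ χe ω hfin ω₀
    ψu νk ν Pind PiK τ' P₀ P hrel
  obtain ⟨χ, hχ⟩ := stub_memberPaneArch harch hinf F₀ F τ n hcpt π e k ℓ eψ hH K cK h2 hcK L F' s hT μ
    χe ω hfin ω₀ ψu νk ν Pind PiK τ' P₀ P hrel
  exact ⟨τ', ψu * νk * ν, P, T, χ, hout, hT', hχ⟩

end Compose

/-! ## The reshaped `stub_package`: family assembly (LANDED, `…PackageFamily.lean`, p95457) ∘ split -/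

/-- **The reshaped `stub_package` (CHECKED COMPOSITION over the split)**: the facts of
`pkg_member_of_split`, the crux data with `Hyps` and `F` not totally real; conclusion = the family
output consumed by the landed `stub_patch` (through `stub_galoisOverK`). -/
theorem stub_package''
    (hAI : automorphicInduction_cyclic_cuspidal_unramified)
    (hBC : ∀ (n : ℕ) (F E : Type) [Field F] [NumberField F] [Field E] [NumberField E] [Algebra F E]
      [IsGalois F E], (Module.finrank F E).Prime →
      ∀ (hF : isCompact_glFiniteIntegralLevel n F) (π : CuspidalAutomorphicRepData n F hF),
        (∃ v : HeightOneSpectrum (𝓞 F), ¬ Algebra.IsUnramifiedIn (𝓞 E) v.asIdeal ∧ π.1.IsUnramifiedAt v) →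
        ∀ (hE : isCompact_glFiniteIntegralLevel n E),
          ∃ P : CuspidalAutomorphicRepData n E hE, IsUnramifiedBaseChangeLift π.1 P.1)
    (hext : ∀ (F₀ K : Type) [Field F₀] [NumberField F₀] [Field K] [NumberField K] [Algebra F₀ K]
      (c : K ≃ₐ[F₀] K), Module.finrank F₀ K = 2 → c ≠ 1 →
      ∀ (χ₀ : HeckeCharacter F₀), χ₀.IsUnitary →
      ∀ (U : Set (HeightOneSpectrum (𝓞 K))),
        (∀ u ∈ U, c • u ∈ U → χ₀.IsUnramifiedAt (u.under (𝓞 F₀))) →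
        ∃ χ : HeckeCharacter K, χ.IsUnitary ∧
          (∀ x, χ (AdeleRing.ideleBaseChange F₀ K x) = χ₀ x) ∧ ∀ u ∈ U, χ.IsUnramifiedAt u)
    (harch : ArthurClozel1989_strongLifting_archimedean)
    (hHen : Henniart2012_infinityType_of_automorphicInduction)
    (hinf : ∀ (N : ℕ) (K : Type) [Field K] [NumberField K] (hK : isCompact_glFiniteIntegralLevel N K)
      (P : AutomorphicRepData (AutomorphyDatum.gl N K hK)), P.exists_hasInfinityType)
    (hCFT : artinReciprocity_character_archimedean)
    (hex : ∀ (F E : Type) [Field F] [NumberField F] [Field E] [NumberField E] [Algebra F E] (c : E ≃ₐ[F] E), Module.finrank F E = 2 → c ≠ 1 → ∀ (N : ℕ) (hcpt : isCompact_glFiniteIntegralLevel N E) (P : CuspidalAutomorphicRepData N E hcpt), 0 < N → P.1.IsConjSelfDualAE c → ∃ κ : ℤˣ, P.1.HasAsaiSign c κ)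
    (hpin : ∀ (F E : Type) [Field F] [NumberField F] [Field E] [NumberField E] [Algebra F E] (c : E ≃ₐ[F] E), Module.finrank F E = 2 → c ≠ 1 → ∀ (N : ℕ) (hcpt : isCompact_glFiniteIntegralLevel N E) (P : CuspidalAutomorphicRepData N E hcpt) (κ : ℤˣ) (χ : (E →+* ℂ) → Multiset ℂ) (σ : E →+* ℂ) (r : ℝ), 0 < N → P.1.IsConjSelfDualAE c → P.1.HasAsaiSign c κ → P.1.HasArchParameter χ → NumberField.ComplexEmbedding.IsConj σ c → (χ σ).Nodup → (∀ a ∈ χ σ, ∃ m : ℤ, a = (m : ℂ) + (r : ℂ)) → ∀ a ∈ χ σ, ∃ m : ℤ, a = (m : ℂ) + ((N : ℂ) - 1) / 2 + (1 - ((κ : ℤ) : ℂ)) / 4)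
    (hpane : ∀ (F₀ K F' L : Type) [Field F₀] [NumberField F₀] [Field K] [NumberField K] [Field F'] [NumberField F'] [Field L] [NumberField L] [Algebra F₀ K] [Algebra K L] [Algebra F' L] (cK : K ≃ₐ[F₀] K) (s : L ≃ₐ[F'] L), Module.finrank F₀ K = 2 → Module.finrank K L = 2 → Module.finrank F' L = 2 → cK ≠ 1 → s ≠ 1 → (∀ x : K, s (algebraMap K L x) = algebraMap K L (cK x)) → ∀ (n : ℕ) (hL : isCompact_glFiniteIntegralLevel n L) (hK : isCompact_glFiniteIntegralLevel (2 * n) K) (P : CuspidalAutomorphicRepData n L hL) (Q : CuspidalAutomorphicRepData (2 * n) K hK) (χ : (L →+* ℂ) → Multiset ℂ) (σ : L →+* ℂ), 0 < n → IsAutomorphicInductionAlong P.1 Q.1 → P.1.IsConjSelfDualAE s → Q.1.IsConjSelfDualAE cK → P.1.HasArchParameter χ → NumberField.ComplexEmbedding.IsConj σ s → (χ σ).Nodup → Multiset.card (χ σ) = n → (∀ a ∈ χ σ, ∃ m : ℤ, a = (m : ℂ) + 1 / 2) → Q.1.HasAsaiSign cK 1) :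
    ∀ (F₀ F : Type) [Field F₀] [NumberField F₀] [Field F] [NumberField F] [Algebra F₀ F]
      (τ : F ≃ₐ[F₀] F) (n : ℕ) (hcpt : isCompact_glFiniteIntegralLevel n F)
      (π : CuspidalAutomorphicRepData n F hcpt) (e : FramedGaloisRep F₀ ℂ 1) (k : ℤ)
      (ℓ : ℕ) [Fact ℓ.Prime] (ι : PadicAlgCl ℓ ≃+* ℂ) (eψ : FramedGaloisRep F ℂ 1),
      Hyps τ n π e k ℓ eψ → ¬ IsTotallyReal F →
    ∃ (m : ℕ) (B : Set ℕ), m ≠ 0 ∧ B.Finite ∧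
    ∃ (hK : ∀ D : QuadraticFamily.GoodPrime F₀ m B,
        isCompact_glFiniteIntegralLevel (2 * n) (QuadraticFamily.sqrtNegField F₀ D.1))
      (τ' : ∀ D : QuadraticFamily.GoodPrime F₀ m B,
        CuspidalAutomorphicRepData (2 * n) (QuadraticFamily.sqrtNegField F₀ D.1) (hK D))
      (T : ∀ D : QuadraticFamily.GoodPrime F₀ m B,
        InfinityType (QuadraticFamily.sqrtNegField F₀ D.1) (2 * n))
      (ψ₁ : ∀ D : QuadraticFamily.GoodPrime F₀ m B,
        HeckeCharacter (QuadraticFamily.sqrtNegField F₀ D.1)),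
      (∀ (D : QuadraticFamily.GoodPrime F₀ m B) [IsCMField (QuadraticFamily.sqrtNegField F₀ D.1)],
          (τ' D).1.HasInfinityType (T D) ∧ (T D).IsCAlgebraic ∧ (T D).IsWeaklyRegular ∧
          (τ' D).1.IsConjSelfDualAE
            (NumberField.IsCMField.complexConj (QuadraticFamily.sqrtNegField F₀ D.1)) ∧
          (τ' D).1.HasAsaiSign
            (NumberField.IsCMField.complexConj (QuadraticFamily.sqrtNegField F₀ D.1)) 1 ∧
          (ψ₁ D).IsAlgebraic) ∧
      (∀ D : QuadraticFamily.GoodPrime F₀ m B,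
        ∀ᶠ u : HeightOneSpectrum (𝓞 (QuadraticFamily.sqrtNegField F₀ D.1)) in Filter.cofinite,
        ∀ (v : HeightOneSpectrum (𝓞 F₀)) (α : HeightOneSpectrum (𝓞 F) → Multiset ℂ)
          (c : HeightOneSpectrum (𝓞 F) → ℂ), u.under (𝓞 F₀) = v → ((ℓ : ℕ) : 𝓞 F₀) ∉ v.asIdeal →
        (∀ w : HeightOneSpectrum (𝓞 F), w.under (𝓞 F₀) = v → w.asIdeal.ramificationIdx (𝓞 F₀) = 1 ∧
            π.1.HasSatakeParamAt w (α w) ∧ eψ.IsUnramifiedAt w ∧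
            eψ.HasFrobCharpolyAt w (Polynomial.X - Polynomial.C (c w))) →
        ((ℓ : ℕ) : 𝓞 (QuadraticFamily.sqrtNegField F₀ D.1)) ∉ u.asIdeal ∧ (ψ₁ D).IsUnramifiedAt u ∧
        ∃ β : Multiset ℂ, (τ' D).1.HasSatakeParamAt u β ∧
          arithFrobPolyOfSatake ι u.residueCard (2 * n)
              (β.map (fun b ↦ b * ((ψ₁ D).valueAtUniformizer u)⁻¹)) =
            (((∏ᶠ w ∈ {w : HeightOneSpectrum (𝓞 F) | w.under (𝓞 F₀) = v},
              Polynomial.expand (PadicAlgCl ℓ) (w.asIdeal.inertiaDeg (𝓞 F₀))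
                (arithFrobPolyOfSatake ι w.residueCard n ((α w).map (fun a ↦ a * c w)))).roots.map
            (fun x ↦ Polynomial.X - Polynomial.C (x ^ u.asIdeal.inertiaDeg (𝓞 F₀)))).prod)) ∧
      (∀ (v : HeightOneSpectrum (𝓞 F₀)) (α : HeightOneSpectrum (𝓞 F) → Multiset ℂ)
          (c : HeightOneSpectrum (𝓞 F) → ℂ), ((ℓ : ℕ) : 𝓞 F₀) ∉ v.asIdeal →
        (∀ w : HeightOneSpectrum (𝓞 F), w.under (𝓞 F₀) = v → w.asIdeal.ramificationIdx (𝓞 F₀) = 1 ∧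
            π.1.HasSatakeParamAt w (α w) ∧ eψ.IsUnramifiedAt w ∧
            eψ.HasFrobCharpolyAt w (Polynomial.X - Polynomial.C (c w))) →
        ∃ D : QuadraticFamily.GoodPrime F₀ m B,
          (v.asIdeal.primesOver (𝓞 (QuadraticFamily.sqrtNegField F₀ D.1))).ncard = 2 ∧
          ∃ u : HeightOneSpectrum (𝓞 (QuadraticFamily.sqrtNegField F₀ D.1)), u.under (𝓞 F₀) = v ∧
            ((ℓ : ℕ) : 𝓞 (QuadraticFamily.sqrtNegField F₀ D.1)) ∉ u.asIdeal ∧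
            (ψ₁ D).IsUnramifiedAt u ∧
            ∃ β : Multiset ℂ, (τ' D).1.HasSatakeParamAt u β ∧
              arithFrobPolyOfSatake ι u.residueCard (2 * n)
                  (β.map (fun b ↦ b * ((ψ₁ D).valueAtUniformizer u)⁻¹)) =
                (∏ᶠ w ∈ {w : HeightOneSpectrum (𝓞 F) | w.under (𝓞 F₀) = v},
                  Polynomial.expand (PadicAlgCl ℓ) (w.asIdeal.inertiaDeg (𝓞 F₀))
                    (arithFrobPolyOfSatake ι w.residueCard n ((α w).map (fun a ↦ a * c w))))) := by
  intro F₀ F _ _ _ _ _ τ n hcpt π e k ℓ _ ι eψ hH hF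
  exact stub_package_of_member F₀ F hH.1 hH.2.1 n hcpt π ℓ ι eψ fun K _ _ _ _ h2 hram hemp ↦
    pkg_member_of_split hAI hBC hext harch hHen hinf hCFT hex hpin hpane F₀ F τ n hcpt π e k ℓ ι eψ hH
      hF K h2 hram hemp



/-- **Registered anchor** of this composition file (stub registry of stmt-Langlands-10902): a degenerate but
honest instance of the member composition's bookkeeping — a place of an extension lying over a place prime
to `ℓ` is prime to `ℓ` (`natCast_not_mem_of_under_eq` of the landed family file, restated at universe 0
for `F₀`-algebras). [folklore] -/
theorem packageCompose_anchor : ∀ (F₀ K : Type) [Field F₀] [NumberField F₀] [Field K] [NumberField K] [Algebra F₀ K] (ℓ : ℕ) (u : HeightOneSpectrum (𝓞 K)) (v : HeightOneSpectrum (𝓞 F₀)), u.under (𝓞 F₀) = v → ((ℓ : ℕ) : 𝓞 F₀) ∉ v.asIdeal → ((ℓ : ℕ) : 𝓞 K) ∉ u.asIdeal :=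
  fun _ _ _ _ _ _ _ _ _ _ huv hv => natCast_not_mem_of_under_eq huv hv

end Summit.Langlands.Langlands.Theorems.HostInducedRep.OneTransparentPane


end
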